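import Summits.CriticalPhenomena.CardyFormulaZ2.Theorems.CardyAnchoredRigiditySubseqCardyJointLimitSymmetry
import Literature.Probability.Percolation.QuadCrossingRotationInvarianceOfThm21

/-!
# Joint sequential limits and the Schramm–Smirnov quad-crossing probabilities; rotations (DKKMO)
# (crux `SubseqCardy`, stmt-CriticalPhenomena-5768, line `registered`: structure of joint limits, part 3)

Route `CardyAnchoredRigidity` (decl shared with `CardyLocalRigidity`), sub-problem `CardyFormulaZ2`.
Part 2 (`…SubseqCardyJointLimitSymmetry.lean`) proved that every joint sequential limit `g` of the
bond-`ℤ²` crossing probabilities `bondDomainCrossingProb` (G02's discretisation) is invariant under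
translations and under the point group `D₄`. Rotations by arbitrary angles are the theorem of
Duminil-Copin–Kozlowski–Krachun–Manolescu–Oulamara (arXiv:2012.11672, Cor. 1.3 at `q = 1`), vendored in
the tree PER QUAD for the Schramm–Smirnov crossing event as the named fact
`dkkmo_crossing_rotation_invariance` (itself reduced in the tree to `DKKMO2020_thm21_quadCrossingProb`
resp. `dkkmo_theorem_1_2` plus the PROVED `SchrammSmirnov2011_lemma_5_1_holds`). This file supplies the
missing dictionary and draws the consequence:

* `JointLimit.eventually_abs_crude_sub_quadCrossingProb_le`,
  `JointLimit.eventually_abs_bond_sub_quadCrossingProb_le` — **per conformal rectangle, G02's crossing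
  probability, the crude standard-embedding one and Schramm–Smirnov's `quadCrossingProb` are
  asymptotically equal** (`|bondDomainCrossingProb R δ - quadCrossingProb δ R| ≤ ε` eventually):
  Schramm–Smirnov (5.1) at the model quad `Q₀` of a square model of `R` gives `Q' < Q₀ < Q''` whose
  crossing events differ by `≤ ε` in probability, and BOTH the crude event (fattened/thinned sandwich
  of the tree) and the quad-crossing event of `R` (`= {Q₀ crossed}`, `quadCrossing_eq_setOf_exists_isCrossing`)
  lie between `{Q'' crossed}` and `{Q' crossed}` up to null sets; bond ≈ crude is `stub_bondNearCrude`.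
* `JointLimit.map_rotateQuad` / registered sub-goal `jointLimit_rotationInvariant_of_dkkmo` —
  **conditional on `dkkmo_crossing_rotation_invariance`, every joint sequential limit is invariant
  under ALL rotations about the origin**, hence (with part 2) under every orientation-preserving
  Euclidean motion and every reflection of the plane. What then remains of S2 `stub_limitConformal`
  is exactly dilation + inversion (Möbius) covariance of one joint limit.

References: O. Schramm, S. Smirnov, Ann. Probab. 39 (2011) §1.3, Lemma 5.1, (5.1);
H. Duminil-Copin, K. K. Kozlowski, D. Krachun, I. Manolescu, M. Oulamara, *Rotational invariance in
critical planar lattice models*, arXiv:2012.11672, Cor. 1.3.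
-/

noncomputable section

namespace Summit.CriticalPhenomena.CardyFormulaZ2.Cruxes.SubseqCardy.Birth

open Set Filter Topology Metric MeasureTheory
open Literature.Probability.RandomPlanarGeometry (ConformalRectangle MarkedDomain)
open Literature.Probability.LatticeModels
open Literature.Probability.Percolation (IsSquareModel exists_isSquareModel BondConfig openEdgeUnion
  bondPercolation half embDomainCrossing bondDomainCrossingProb quadCrossing quadCrossingProb rotateQuad
  rotateQuad_add rotateQuad_zero quadCrossing_eq_setOf_exists_isCrossing dkkmo_crossing_rotation_invariance)
open Literature.Probability.Percolation.QuadCrossing (Quad)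
open Literature.Probability.Percolation.QuadCrossing.Quad (Dominated StrictlyDominated)
open Summit.CriticalPhenomena.CardyFormulaZ2.Theorems (tendsto_div_sqrt_two)
open Summit.CriticalPhenomena.CardyFormulaZ2.Theorems.CornerLineDescent.SymmetricSeed (bondStdCrossingProb
  upperCrossing_subset_fatQuad_crossing thinQuad_crossing_subset_lowerCrossing crude_subset_upperCrossing)
open Summit.CriticalPhenomena.CardyFormulaZ2.Theorems.CornerLineDescent.SymmetricSeed.Freeze (upperCrossing
  lowerCrossing lowerCrossing_subset_embDomainCrossing exists_radius_left exists_radius_right exists_modulus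
  dist_chartQuad_le chartQuad fatQuad thinQuad tmodel fatQuad_eq thinQuad_eq carrier_chartQuad
  side_zero_chartQuad side_two_chartQuad tmodel_image_Icc tmodel_image_left tmodel_image_right)

namespace JointLimit

variable {u : ℕ → ℝ} {g : ConformalRectangle → ℝ}

/-! ### Crude crossings versus Schramm–Smirnov quad crossings, per rectangle -/

/-- **The crude crossing probability at crude mesh `δ` and the Schramm–Smirnov quad-crossing
probability at lattice spacing `δ√2` of the same conformal rectangle are asymptotically equal**:
eventually `|bondStdCrossingProb R δ - quadCrossingProb (δ * √2) R| ≤ ε`. Both events are caught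
between the crossing events of the quads `Q'' > Q₀ > Q'` of Schramm–Smirnov's (5.1) at the model
quad `Q₀` of a square model of `R` (the crude one through the fattened / thinned sandwich, the quad
one because it IS `{Q₀ crossed}`), and `P_{1/2}[Q' crossed ∧ ¬ Q'' crossed] ≤ ε`.
[cite: SchrammSmirnov2011, §5 Lemma 5.1 and eq. (5.1)] -/
theorem eventually_abs_crude_sub_quadCrossingProb_le (R : ConformalRectangle) {ε : ℝ} (hε : 0 < ε) :
    ∀ᶠ δ in 𝓝[>] (0:ℝ), |bondStdCrossingProb R δ - quadCrossingProb (δ * Real.sqrt 2) R| ≤ ε := by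
  obtain ⟨Φ, hΦ⟩ := exists_isSquareModel R
  -- Schramm–Smirnov (5.1) at the model chart quad, and the two domination radii
  obtain ⟨Q', Q'', hQ', hQ'', δ₀, hδ₀, hE⟩ :=
    Literature.Probability.Percolation.QuadCrossing.Quad.continuity_of_lemma_5_1
      Literature.Probability.Percolation.QuadCrossing.SchrammSmirnov2011_lemma_5_1_holds
      (chartQuad (tmodel Φ) (-1) 1 (-1) 1 (by norm_num) (by norm_num)) (ENNReal.ofReal ε)
      (ENNReal.ofReal_pos.2 hε)
  obtain ⟨r₁, hr₁, hdom₁⟩ := exists_radius_left hQ'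
  obtain ⟨r₂, hr₂, hdom₂⟩ := exists_radius_right hQ''
  -- the model quad is the quad of `R`
  have hc : (chartQuad (tmodel Φ) (-1) 1 (-1) 1 (by norm_num) (by norm_num)).carrier = closure R.carrier := by
    rw [carrier_chartQuad, tmodel_image_Icc hΦ]
  have h0 : (chartQuad (tmodel Φ) (-1) 1 (-1) 1 (by norm_num) (by norm_num)).side 0 = R.arc 0 := by
    rw [side_zero_chartQuad, tmodel_image_left hΦ]
  have h2 : (chartQuad (tmodel Φ) (-1) 1 (-1) 1 (by norm_num) (by norm_num)).side 2 = R.arc 2 := by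
    rw [side_two_chartQuad, tmodel_image_right hΦ]
  have hdom0' : Dominated Q' (chartQuad (tmodel Φ) (-1) 1 (-1) 1 (by norm_num) (by norm_num)) :=
    hdom₁ _ (by rw [dist_self]; exact hr₁)
  have hdom0'' : Dominated (chartQuad (tmodel Φ) (-1) 1 (-1) 1 (by norm_num) (by norm_num)) Q'' :=
    hdom₂ _ (by rw [dist_self]; exact hr₂)
  set r : ℝ := min (min r₁ r₂) 1 with hrdef
  have hr : 0 < r := lt_min (lt_min hr₁ hr₂) one_pos
  have hrr₁ : r ≤ r₁ := (min_le_left _ _).trans (min_le_left _ _)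
  have hrr₂ : r ≤ r₂ := (min_le_left _ _).trans (min_le_right _ _)
  have hr4 : 0 < r / 4 := by positivity
  obtain ⟨θ, hθ, hmod⟩ := exists_modulus (tmodel Φ) hr4
  set s : ℝ := min (1 / 2) (θ / 4) with hsdef
  have hs : 0 < s := lt_min one_half_pos (by positivity)
  have hs1 : s ≤ 1 / 2 := min_le_left _ _
  have hsθ : 4 * s ≤ θ := by rw [hsdef]; linarith [min_le_right (1 / 2 : ℝ) (θ / 4)]
  obtain ⟨g, hg, hup⟩ := upperCrossing_subset_fatQuad_crossing R Φ hΦ s hs hs1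
  obtain ⟨t, ht, hts, κ, hκ, rr, hrr, hlow⟩ := thinQuad_crossing_subset_lowerCrossing R Φ hΦ s hs hs1 s hs
  have hdistP : dist (chartQuad (tmodel Φ) (-1 + s) (1 - s) (-1 - s) (1 + s) (by linarith) (by linarith))
      (chartQuad (tmodel Φ) (-1) 1 (-1) 1 (by norm_num) (by norm_num)) ≤ r / 4 := by
    refine dist_chartQuad_le hr4.le hmod _ _ ⟨by linarith, by linarith⟩ ⟨by linarith, by linarith⟩
      ⟨by linarith, by linarith⟩ ⟨by linarith, by linarith⟩ ?_
    have e1 : -1 + s + 1 = s := by ring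
    have e2 : 1 - s - 1 = -s := by ring
    have e3 : -1 - s + 1 = -s := by ring
    have e4 : 1 + s - 1 = s := by ring
    rw [e1, e2, e3, e4, abs_neg, abs_of_pos hs]
    linarith
  have hdistM : dist (chartQuad (tmodel Φ) (-1 - t) (1 + t) (-1 + s) (1 - s) (by linarith) (by linarith))
      (chartQuad (tmodel Φ) (-1) 1 (-1) 1 (by norm_num) (by norm_num)) ≤ r / 4 := by
    refine dist_chartQuad_le hr4.le hmod _ _ ⟨by linarith, by linarith⟩ ⟨by linarith, by linarith⟩
      ⟨by linarith, by linarith⟩ ⟨by linarith, by linarith⟩ ?_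
    have e1 : -1 - t + 1 = -t := by ring
    have e2 : 1 + t - 1 = t := by ring
    have e3 : -1 + s + 1 = s := by ring
    have e4 : 1 - s - 1 = -s := by ring
    rw [e1, e2, e3, e4, abs_neg, abs_neg, abs_of_pos hs, abs_of_pos ht]
    linarith
  have hdomP : Dominated Q' (fatQuad (tmodel Φ) s) := by
    rw [fatQuad_eq _ hs (by linarith)]
    exact hdom₁ _ (lt_of_le_of_lt hdistP (by linarith))
  have hdomM : Dominated (thinQuad (tmodel Φ) t s) Q'' := by
    rw [thinQuad_eq _ ht hs (by linarith)]
    exact hdom₂ _ (lt_of_le_of_lt hdistM (by linarith))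
  -- the meshes
  have hδ₁ : 0 < min (min (min g rr / 4) (δ₀ / 2)) (κ / 2) := by positivity
  filter_upwards [Ioo_mem_nhdsGT hδ₁] with δ hδ
  rw [mem_Ioo] at hδ
  obtain ⟨hδ, hδ'⟩ := hδ
  have hδgr : δ < min g rr / 4 := hδ'.trans_le ((min_le_left _ _).trans (min_le_left _ _))
  have hδδ₀ : δ < δ₀ / 2 := hδ'.trans_le ((min_le_left _ _).trans (min_le_right _ _))
  have hδκ : δ < κ / 2 := hδ'.trans_le (min_le_right _ _)
  have hsq2 : Real.sqrt 2 < 2 := by linarith [Real.sqrt_two_lt_three_halves]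
  have hsq0 : 0 < Real.sqrt 2 := Real.sqrt_pos.2 two_pos
  have hm2 : δ * Real.sqrt 2 < 2 * δ := by nlinarith
  have hmpos : 0 < δ * Real.sqrt 2 := by positivity
  have hmδ₀ : δ * Real.sqrt 2 < δ₀ := by linarith
  have hκδ : Real.sqrt 2 * δ ≤ κ := by nlinarith
  have hgr_g : min g rr ≤ g := min_le_left _ _
  have hgr_r : min g rr ≤ rr := min_le_right _ _
  set ρ : ℝ := min g rr / 2 with hρdef
  have hρ : 0 ≤ ρ := by positivity
  have h2δ : 2 * δ ≤ ρ := by rw [hρdef]; linarith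
  have hmg : δ * Real.sqrt 2 + ρ ≤ g := by rw [hρdef]; linarith
  have hmr : δ * Real.sqrt 2 + ρ ≤ rr := by rw [hρdef]; linarith
  set m : ℝ := δ * Real.sqrt 2 with hm
  set P := bondPercolation (zdGraph 2) half with hP
  set E : Set (BondConfig (Site 2)) := {ω | (∃ K, Q'.IsCrossing K ∧ K ⊆ openEdgeUnion m ω) ∧
    ¬ ∃ K, Q''.IsCrossing K ∧ K ⊆ openEdgeUnion m ω} with hEdef
  set G : Set (BondConfig (Site 2)) := {ω | ω ⊆ (zdGraph 2).edgeSet} with hGdef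
  set A : Set (BondConfig (Site 2)) :=
    embDomainCrossing squareLatticeEmbedding.z R.carrier δ (R.arc 0) (R.arc 2) with hAdef
  set B : Set (BondConfig (Site 2)) := {ω | ∃ K,
    (chartQuad (tmodel Φ) (-1) 1 (-1) 1 (by norm_num) (by norm_num)).IsCrossing K ∧ K ⊆ openEdgeUnion m ω}
    with hBdef
  have hBq : quadCrossing R m = B := quadCrossing_eq_setOf_exists_isCrossing hc h0 h2 hmpos
  -- the two inclusions of events
  have hinclA : B ⊆ A ∪ (E ∪ Gᶜ) := by
    rintro ω ⟨K, hK, hKO⟩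
    by_cases hωG : ω ⊆ (zdGraph 2).edgeSet
    swap
    · exact Or.inr (Or.inr hωG)
    obtain ⟨K', hK'K, hK'⟩ := hdom0' K hK
    by_cases hQ2 : ∃ K, Q''.IsCrossing K ∧ K ⊆ openEdgeUnion m ω
    · obtain ⟨K₂, hK₂, hK₂O⟩ := hQ2
      obtain ⟨K₃, hK₃K, hK₃⟩ := hdomM K₂ hK₂
      exact Or.inl (lowerCrossing_subset_embDomainCrossing R hδ hρ hκδ hωG
        (hlow δ ρ hδ hρ hmr ω K₃ hK₃ (hK₃K.trans hK₂O)))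
    · exact Or.inr (Or.inl ⟨⟨K', hK', hK'K.trans hKO⟩, hQ2⟩)
  have hinclB : A ⊆ B ∪ (E ∪ Gᶜ) := by
    intro ω hω
    by_cases hωG : ω ⊆ (zdGraph 2).edgeSet
    swap
    · exact Or.inr (Or.inr hωG)
    have hup' : ω ∈ upperCrossing R ρ δ := crude_subset_upperCrossing R ρ δ hδ.le h2δ hω
    obtain ⟨K, hK, hKO⟩ := hup δ ρ hδ hρ hmg ω hωG hup'
    obtain ⟨K', hK'K, hK'⟩ := hdomP K hK
    by_cases hQ2 : ∃ K, Q''.IsCrossing K ∧ K ⊆ openEdgeUnion m ω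
    · obtain ⟨K₂, hK₂, hK₂O⟩ := hQ2
      obtain ⟨K₀, hK₀K, hK₀⟩ := hdom0'' K₂ hK₂
      exact Or.inl ⟨K₀, hK₀, hK₀K.trans hK₂O⟩
    · exact Or.inr (Or.inl ⟨⟨K', hK', hK'K.trans hKO⟩, hQ2⟩)
  -- the measures
  have hGc : P.real Gᶜ = 0 := by
    rw [measureReal_def, ENNReal.toReal_eq_zero_iff]
    left
    have hae := Literature.Probability.Percolation.ae_subset_edgeSet (zdGraph 2) half
    rw [Filter.Eventually, MeasureTheory.mem_ae_iff] at hae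
    exact hae
  have hEε : P.real E ≤ ε := ENNReal.toReal_le_of_le_ofReal hε.le (hE m hmpos hmδ₀)
  have hEG : P.real (E ∪ Gᶜ) ≤ ε :=
    calc P.real (E ∪ Gᶜ) ≤ P.real E + P.real Gᶜ := measureReal_union_le _ _
      _ ≤ ε := by rw [hGc, add_zero]; exact hEε
  have hA : P.real B ≤ P.real A + ε :=
    calc P.real B ≤ P.real (A ∪ (E ∪ Gᶜ)) := measureReal_mono hinclA
      _ ≤ P.real A + P.real (E ∪ Gᶜ) := measureReal_union_le _ _
      _ ≤ P.real A + ε := by gcongr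
  have hB : P.real A ≤ P.real B + ε :=
    calc P.real A ≤ P.real (B ∪ (E ∪ Gᶜ)) := measureReal_mono hinclB
      _ ≤ P.real B + P.real (E ∪ Gᶜ) := measureReal_union_le _ _
      _ ≤ P.real B + ε := by gcongr
  show |P.real A - quadCrossingProb m R| ≤ ε
  rw [quadCrossingProb, hBq, abs_sub_le_iff]
  constructor <;> linarith

/-- **G02's crossing probability and Schramm–Smirnov's quad-crossing probability of a conformal
rectangle are asymptotically equal**: eventually `|bondDomainCrossingProb R δ - quadCrossingProb δ R| ≤ ε`
(bond ≈ crude at crude mesh `δ/√2`, `stub_bondNearCrude`; crude ≈ quad with `(δ/√2)·√2 = δ`).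
[cite: SchrammSmirnov2011, §5 Lemma 5.1 and eq. (5.1)] -/
theorem eventually_abs_bond_sub_quadCrossingProb_le (R : ConformalRectangle) {ε : ℝ} (hε : 0 < ε) :
    ∀ᶠ δ in 𝓝[>] (0:ℝ), |bondDomainCrossingProb R δ - quadCrossingProb δ R| ≤ ε := by
  have hε2 : 0 < ε / 2 := half_pos hε
  have h1 := stub_bondNearCrude R (ε / 2) hε2
  have h2 : ∀ᶠ δ in 𝓝[>] (0:ℝ), |bondStdCrossingProb R (δ / Real.sqrt 2) -
      quadCrossingProb (δ / Real.sqrt 2 * Real.sqrt 2) R| ≤ ε / 2 :=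
    tendsto_div_sqrt_two.eventually (eventually_abs_crude_sub_quadCrossingProb_le R hε2)
  filter_upwards [h1, h2] with δ hδ1 hδ2
  rw [div_mul_cancel₀ δ (Real.sqrt_pos.2 two_pos).ne'] at hδ2
  rw [← bondStdCrossingProb_eq] at hδ1
  rw [abs_le] at hδ1 hδ2 ⊢
  constructor <;> linarith [hδ1.1, hδ1.2, hδ2.1, hδ2.2]

/-! ### Rotation invariance of joint sequential limits, conditional on DKKMO -/

/-- Angles in `(0, π)`: conditional on `dkkmo_crossing_rotation_invariance`, every joint sequential
limit satisfies `g (e^{iα} R) = g R`. [cite: DKKMO2020Rotational, Cor. 1.3 (q = 1)] -/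
theorem map_rotateQuad_of_mem_Ioo (hdk : dkkmo_crossing_rotation_invariance)
    (hu : Tendsto u atTop (𝓝[>] (0 : ℝ)))
    (hg : ∀ R : ConformalRectangle, Tendsto (fun n => bondDomainCrossingProb R (u n)) atTop (𝓝 (g R)))
    (R : ConformalRectangle) {α : ℝ} (hα : α ∈ Ioo 0 Real.pi) :
    g (rotateQuad α R) = g R := by
  refine eq_of_forall_eventually_abs_sub_le hg fun ε hε => ?_
  rw [mem_Ioo] at hα
  -- an `ε'` below `ε/3` and below the distance of `α` to `{0, π}`
  set ε' : ℝ := min (ε / 3) (min α (Real.pi - α) / 2) with hε'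
  have hε'pos : 0 < ε' := lt_min (by positivity) (by
    have : 0 < min α (Real.pi - α) := lt_min hα.1 (by linarith)
    linarith)
  have hε'3 : ε' ≤ ε / 3 := min_le_left _ _
  have hε'α : ε' < α := by
    have h1 : ε' ≤ min α (Real.pi - α) / 2 := min_le_right _ _
    have h2 : min α (Real.pi - α) ≤ α := min_le_left _ _
    linarith
  have hε'π : α < Real.pi - ε' := by
    have h1 : ε' ≤ min α (Real.pi - α) / 2 := min_le_right _ _
    have h2 : min α (Real.pi - α) ≤ Real.pi - α := min_le_right _ _
    linarith [hα.2]
  obtain ⟨δ₀, hδ₀, hrot⟩ := hdk R ε' hε'pos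
  have h1 := hu.eventually (eventually_abs_bond_sub_quadCrossingProb_le (rotateQuad α R) hε'pos)
  have h2 := hu.eventually (eventually_abs_bond_sub_quadCrossingProb_le R hε'pos)
  have h3 : ∀ᶠ n in atTop, u n ∈ Ioo 0 δ₀ := hu.eventually (Ioo_mem_nhdsGT hδ₀)
  filter_upwards [h1, h2, h3] with n hn1 hn2 hn3
  have key := hrot α ⟨hε'α, hε'π⟩ (u n) hn3
  rw [abs_le] at hn1 hn2 key ⊢
  constructor <;> linarith [hn1.1, hn1.2, hn2.1, hn2.2, key.1, key.2]

/-- Positive angles, by iterating a small rotation. [cite: DKKMO2020Rotational, Cor. 1.3 (q = 1)] -/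
theorem map_rotateQuad_of_pos (hdk : dkkmo_crossing_rotation_invariance)
    (hu : Tendsto u atTop (𝓝[>] (0 : ℝ)))
    (hg : ∀ R : ConformalRectangle, Tendsto (fun n => bondDomainCrossingProb R (u n)) atTop (𝓝 (g R)))
    {α : ℝ} (hα : 0 < α) (R : ConformalRectangle) :
    g (rotateQuad α R) = g R := by
  -- `α = (N + 1) β` with `β ∈ (0, π)`
  obtain ⟨N, hN⟩ := exists_nat_gt (α / Real.pi)
  set β : ℝ := α / (N + 1) with hβ
  have hN1 : (0 : ℝ) < N + 1 := by positivity
  have hβpos : 0 < β := div_pos hα hN1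
  have hβπ : β < Real.pi := by
    rw [hβ, div_lt_iff₀ hN1]
    have h := (div_lt_iff₀ Real.pi_pos).1 hN
    nlinarith [Real.pi_pos]
  have hiter : ∀ k : ℕ, g (rotateQuad (k * β) R) = g R := by
    intro k
    induction k with
    | zero => simp [rotateQuad_zero]
    | succ k ih =>
      have e : ((k + 1 : ℕ) : ℝ) * β = k * β + β := by push_cast; ring
      rw [e, rotateQuad_add, map_rotateQuad_of_mem_Ioo hdk hu hg _ ⟨hβpos, hβπ⟩, ih]
  have hα' : α = ((N + 1 : ℕ) : ℝ) * β := by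
    rw [hβ]; push_cast; field_simp
  rw [hα']
  exact hiter (N + 1)

/-- **Conditional on DKKMO's rotation invariance of quad-crossing probabilities, every joint
sequential limit of the bond-`ℤ²` crossing probabilities is rotation invariant**: `g (e^{iα} R) = g R`
for every angle `α` and every conformal rectangle `R`. [cite: DKKMO2020Rotational, Cor. 1.3 (q = 1)] -/
theorem map_rotateQuad (hdk : dkkmo_crossing_rotation_invariance)
    (hu : Tendsto u atTop (𝓝[>] (0 : ℝ)))
    (hg : ∀ R : ConformalRectangle, Tendsto (fun n => bondDomainCrossingProb R (u n)) atTop (𝓝 (g R)))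
    (α : ℝ) (R : ConformalRectangle) :
    g (rotateQuad α R) = g R := by
  rcases lt_trichotomy α 0 with hα | rfl | hα
  · -- `R = e^{-iα} (e^{iα} R)` with `-α > 0`
    have h := map_rotateQuad_of_pos hdk hu hg (neg_pos.2 hα) (rotateQuad α R)
    rw [← rotateQuad_add, add_neg_cancel, rotateQuad_zero] at h
    exact h.symm
  · rw [rotateQuad_zero]
  · exact map_rotateQuad_of_pos hdk hu hg hα R

end JointLimit

/-- **Registered sub-goal `jointLimit_rotationInvariant_of_dkkmo` (line `registered`, lead c3) —
rotation invariance of every joint sequential limit, conditional on DKKMO**: if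
`dkkmo_crossing_rotation_invariance` holds (DKKMO arXiv:2012.11672 Cor. 1.3 at `q = 1`, per quad; a
named fact of the tree), then for every mesh sequence `u n → 0⁺` and every `g` with
`bondDomainCrossingProb R (u n) → g R` for all conformal rectangles `R`, `g (e^{iα} R) = g R` for every
angle `α` (`JointLimit.map_rotateQuad`, through the dictionary
`JointLimit.eventually_abs_bond_sub_quadCrossingProb_le`). [cite: DKKMO2020Rotational, Cor. 1.3 (q = 1)] -/
theorem jointLimit_rotationInvariant_of_dkkmo : Literature.Probability.Percolation.dkkmo_crossing_rotation_invariance → ∀ u : ℕ → ℝ, Filter.Tendsto u Filter.atTop (nhdsWithin (0 : ℝ) (Set.Ioi 0)) → ∀ g : Literature.Probability.RandomPlanarGeometry.ConformalRectangle → ℝ, (∀ R : Literature.Probability.RandomPlanarGeometry.ConformalRectangle, Filter.Tendsto (fun n => Literature.Probability.Percolation.bondDomainCrossingProb R (u n)) Filter.atTop (nhds (g R))) → ∀ (α : ℝ) (R : Literature.Probability.RandomPlanarGeometry.ConformalRectangle), g (Literature.Probability.Percolation.rotateQuad α R) = g R :=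
  fun hdk _ hu _ hg α R => JointLimit.map_rotateQuad hdk hu hg α R

end Summit.CriticalPhenomena.CardyFormulaZ2.Cruxes.SubseqCardy.Birth

end
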